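import Mathlib

/-!
# C(334) with a ℤ/37 acting semiregularly on the core: the ORBIT-MATRIX level is not obstructed (explicit witness, kernel)

Framing: lottery ticket; floor = certified bounds/negative ranges.  Cell pub-namedobj (venture DiscreteObjects),
target (H), hadamard gen 27; companion of `ConferencePairSymmetric` §3 / `AbelianCore334` (no core of `C(334)` developed over an
abelian group of order `333`).  The next larger structured family is a symmetric normalised conference matrix `C(334)` whose core
`S` (`Sᵀ = S`, `S² = 333 I − J`, `S𝟙 = 0`, zero diagonal, `±1` off it) admits a fixed-point-free automorphism of order `37`
(`P S Pᵀ = S`, nine orbits of size `37`, all `81` blocks circulant).  Its ORBIT MATRIX `M ∈ ℤ^{9×9}` (block row sums) is symmetric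
with `M Mᵀ = 333 I − 37 J` (row square sums `296`, distinct rows inner product `−37`), `M𝟙 = 0`, even diagonal and odd
off-diagonal entries.  Unlike the group-developed case (where `M` is forced to be a group matrix over `ℤ/9` or `(ℤ/3)²` and the
system is EMPTY), the general orbit-matrix system HAS solutions: gen 27's hub-local exact search (code/orbit37_c334_e1.py, pure
Python; 2,109,524 admissible rows, 242 canonical first rows) finds many; this file certifies one of them in the kernel (`decide` / `rfl`, no new `def`), so the census words are exact: 'ℤ/37 semiregular on the core of C(334): orbit matrices
EXIST (kernel witness); ±1 indexing of the nine circulant blocks = beyond bound k'.  No `C(334)` is constructed or excluded here.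
-/

namespace Summit.Ventures.DiscreteObjects.Hadamard

open Matrix

/-- **the orbit-matrix system for a `ℤ/37`-symmetric core of `C(334)` is solvable**: the explicit symmetric integer `9 × 9` matrix
below (found by gen 27's exact search) has `M Mᵀ = 333 I − 37 J`, zero row sums, even diagonal and odd off-diagonal entries
(kernel evaluation). -/
theorem exists_orbitMatrix37_core334 :
    ∃ M : Matrix (Fin 9) (Fin 9) ℤ, Mᵀ = M ∧ M * Mᵀ = (333 : ℤ) • (1 : Matrix (Fin 9) (Fin 9) ℤ) - (37 : ℤ) • Matrix.of (fun _ _ => (1 : ℤ)) ∧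
      (∀ u, ∑ v, M u v = 0) ∧ (∀ u, 2 ∣ M u u) ∧ (∀ u v, u ≠ v → ¬ 2 ∣ M u v) := by
  refine ⟨!![-16, 3, 3, 3, 3, 1, 1, 1, 1;
     3, -4, -7, 5, 13, -1, -3, -3, -3;
     3, -7, 12, 5, -3, -3, -7, 1, -1;
     3, 5, 5, -4, 1, -7, 9, -9, -3;
     3, 13, -3, 1, -4, 1, -9, 1, -3;
     1, -1, -3, -7, 1, -8, -1, 7, 11;
     1, -3, -7, 9, -9, -1, 8, 3, -1;
     1, -3, 1, -9, 1, 7, 3, 8, -9;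
     1, -3, -1, -3, -3, 11, -1, -9, 8], by decide, ?_, by decide, by decide, by decide⟩
  ext i j
  fin_cases i <;> fin_cases j <;> rfl

end Summit.Ventures.DiscreteObjects.Hadamard
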